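import Mathlib

/-!
# `FeketeSOS.FeketeSOSHard` (stmt-ValiantsHypothesis-3996), line `Sketch` — the WEAK order–sparsity inequality is false too

Crux-triage round 1, triager 1 (`Cruxes/FeketeSOSHard/TRIAGE-r1-1.md`).  The card `euler-multiplicity-tau`
(`Cruxes/FeketeSOSHard/SketchIdeator2.lean`, namespace `…Cruxes.FeketeSOSHard.EulerMultiplicityTau`) rests on the
conjecture "additive Hajós / characteristic-`p` Koiran–Skomra" `OrdSparsitySum C` (a cyclic sum `∑_{j<r} A_j B_j` of
products of polynomials of degree `< p` over a field of characteristic `p`, not divisible by `X^p - 1`, vanishes at `X = 1`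
to order at most `C ·` support-sum) and, as its fallback, on the EXPONENT-GAIN form
`OrdSparsitySumWeak C a num den := num < 2*den ∧ ∀ …, ord^den ≤ C · r^a · T^num` ("any `η > 0` in `ord ≤ C r^a T^{2-η}`
already gives the crux's exponent gain for good-reduction representations").  The linear form is refuted for every `C` in
`SketchOrdSparsity.lean` (lead, p90036, `SketchStubs.not_ordSparsitySum`).  THIS FILE refutes the weak form for ALL
parameters `C, a, num, den`, by the same SOCLE TILING: in characteristic `p`, `1 + X + ⋯ + X^{p-1} = (X - 1)^{p-1}`
(Frobenius), and for `p = a₀·(p/a₀) + (p mod a₀)` with `2 ≤ a₀ < p` (so `1 ≤ p mod a₀ < a₀`) the digit tiling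
`1 + X + ⋯ + X^{p-1} = (∑_{i<a₀} X^i)(∑_{j<p/a₀} X^{a₀ j}) + X^{a₀ (p/a₀)}·(∑_{i < p mod a₀} X^i)`
is `r = 2` products of polynomials of degree `< p`, not divisible by `X^p - 1 = (X-1)^p`, of order `p - 1` at `X = 1`, with
support-sum `≤ 2a₀ + p/a₀`.  With `a₀ = ⌊√p⌋`: `T ≤ 3(a₀+1)`, `p - 1 ≥ (a₀-1)(a₀+1)`, hence
`((a₀-1)(a₀+1))^den ≤ C 2^a 3^num (a₀+1)^num ≤ C 2^a 3^num (a₀+1)^{2den-1}` forces `a₀ - 1 ≤ C 2^a 3^{num+den-1}`, absurd for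
`p ≥ (C 2^a 3^{num+den} + 3)²`.  In words: the trivial quadratic bound `ord ≲ T²` is ATTAINED in characteristic `p`
(`ord/T² ≥ 1/9 - o(1)` at the socle), so NO order–sparsity inequality with exponent `< 2` holds for sums of `r ≥ 2` sparse
products unless the order is pinned away from the socle — as the route's surviving char-`p` items do (`CharPSparseSOS`,
`CharPSOSOrderDichotomy`: exact order `(p-1)/2` of `F̄_p`).

The refuted statement is `EulerMultiplicityTau.OrdSparsitySumWeak` VERBATIM (leading conjunct `num < 2 * den` kept,
`pairSparsity A B` unfolded to `∑ j, ((A j).support.card + (B j).support.card)`, bound exponent renamed `a ↦ e`), so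
`ordSparsitySumWeak_false C e num den` is an `Iff.rfl`-bridge to `¬ OrdSparsitySumWeak C e num den` for anyone importing
the Sketch.  The witness is re-derived here in existential form (`socle_witness`, any `2 ≤ a < p`, support-sum `≤ 2a + p/a`)
because the lead's module `Negative.SketchOrdSparsity` is not yet built on the farm snapshot, and the file imports Mathlib
only (independent of the route file, like the lead's; the digit decomposition of `range (a*b)` is inlined in the proof of
`socle_tiling_identity`).  Elementary; theorems only; no facts. [folklore; digit tiling + Frobenius]
-/

namespace Summit.ValiantsHypothesis.ValiantsHypothesis.Theorems.FeketeSOSHard.Negative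

open Polynomial Finset

-- `Summit.ValiantsHypothesis.ValiantsHypothesis.…` is the tree's mandated single-conjunct layout (Sub = Summit).
set_option linter.dupNamespace false

noncomputable section

/-! ## Digit polynomials over an arbitrary (semi)ring -/

section Semiring

variable {K : Type*} [Semiring K]

/-- Support of a finite sum of polynomials is at most the sum of the supports (any semiring). -/
theorem socle_card_support_sum_le {ι : Type*} (s : Finset ι) (f : ι → K[X]) :
    (∑ i ∈ s, f i).support.card ≤ ∑ i ∈ s, (f i).support.card := by
  classical
  induction s using Finset.induction_on with
  | empty => simp
  | @insert a s ha ih =>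
    rw [sum_insert ha, sum_insert ha]
    exact ((card_le_card support_add).trans (card_union_le _ _)).trans (by omega)

/-- A sum of `|s|` monomials `X^{e i}` has at most `|s|` terms (any semiring). -/
theorem socle_card_support_sum_X_pow_le {ι : Type*} (s : Finset ι) (e : ι → ℕ) :
    (∑ i ∈ s, (X : K[X]) ^ e i).support.card ≤ s.card := by
  refine (socle_card_support_sum_le s _).trans ?_
  calc ∑ i ∈ s, ((X : K[X]) ^ e i).support.card ≤ ∑ _i ∈ s, 1 :=
        sum_le_sum fun i _ => by
          rw [← one_mul ((X : K[X]) ^ e i), ← C_1]; exact card_support_C_mul_X_pow_le_one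
    _ = s.card := by simp

/-- `[n]_X = 1 + X + ⋯ + X^{n-1}` has at most `n` terms. -/
theorem socle_card_support_geom_le (n : ℕ) : (∑ i ∈ range n, (X : K[X]) ^ i).support.card ≤ n := by
  simpa using socle_card_support_sum_X_pow_le (K := K) (range n) id

/-- `∑_{j<b} X^{aj}` has at most `b` terms. -/
theorem socle_card_support_step_le (a b : ℕ) :
    (∑ j ∈ range b, (X : K[X]) ^ (a * j)).support.card ≤ b := by
  simpa using socle_card_support_sum_X_pow_le (K := K) (range b) (fun j => a * j)

/-- `deg [n]_X < p` as soon as `n ≤ p` and `0 < p`. -/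
theorem socle_natDegree_geom_lt {n p : ℕ} (h : n ≤ p) (hp : 0 < p) :
    (∑ i ∈ range n, (X : K[X]) ^ i).natDegree < p := by
  refine lt_of_le_of_lt (natDegree_sum_le_of_forall_le _ _ (n := p - 1) fun i hi => ?_) (by omega)
  exact (natDegree_X_pow_le _).trans (by have := mem_range.mp hi; omega)

/-- `deg ∑_{j<b} X^{aj} < p` as soon as `0 < a`, `a b ≤ p` and `0 < p`. -/
theorem socle_natDegree_step_lt {a b p : ℕ} (ha : 0 < a) (hb : a * b ≤ p) (hp : 0 < p) :
    (∑ j ∈ range b, (X : K[X]) ^ (a * j)).natDegree < p := by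
  refine lt_of_le_of_lt (natDegree_sum_le_of_forall_le _ _ (n := p - 1) fun j hj => ?_) (by omega)
  refine (natDegree_X_pow_le _).trans ?_
  have hj' := mem_range.mp hj
  have : a * j < a * b := mul_lt_mul_of_pos_left hj' ha
  omega

end Semiring

/-- **The digit tiling** `∑_{m < ab+c} X^m = [a]_X · ∑_{j<b} X^{aj} + X^{ab} · [c]_X`
(every `m < ab + c` is uniquely `i + a j` with `i < a`, `j < b`, or `ab + i` with `i < c`). [folklore] -/
theorem socle_tiling_identity (K : Type*) [CommSemiring K] (a b c : ℕ) :
    (∑ m ∈ range (a * b + c), (X : K[X]) ^ m) =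
      (∑ i ∈ range a, (X : K[X]) ^ i) * (∑ j ∈ range b, (X : K[X]) ^ (a * j)) +
        X ^ (a * b) * ∑ i ∈ range c, (X : K[X]) ^ i := by
  -- digit decomposition of `range (a*b)`: `m = k + a j`, `k < a`, `j < b` (inlined; cf. the disprover's `sum_range_mul_eq`)
  have hdigits : ∀ b' : ℕ, (∑ m ∈ range (a * b'), (X : K[X]) ^ m) =
      ∑ j ∈ range b', ∑ k ∈ range a, (X : K[X]) ^ (k + a * j) := by
    intro b'
    induction b' with
    | zero => simp
    | succ b' ih =>
      rw [Nat.mul_succ, sum_range_add, ih, sum_range_succ]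
      congr 1
      exact sum_congr rfl fun k _ => by rw [add_comm]
  have h1 : (∑ i ∈ range a, (X : K[X]) ^ i) * (∑ j ∈ range b, (X : K[X]) ^ (a * j)) =
      ∑ m ∈ range (a * b), (X : K[X]) ^ m := by
    rw [sum_mul_sum, hdigits b, sum_comm]
    exact sum_congr rfl fun j _ => sum_congr rfl fun k _ => (pow_add _ _ _).symm
  have h2 : (X : K[X]) ^ (a * b) * (∑ i ∈ range c, (X : K[X]) ^ i) =
      ∑ k ∈ range c, (X : K[X]) ^ (a * b + k) := by
    rw [mul_sum]
    exact sum_congr rfl fun k _ => (pow_add _ _ _).symm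
  rw [sum_range_add, h1, h2]

/-! ## The witness over `ZMod p` -/

/-- `1 + X + ⋯ + X^{p-1} = (X - 1)^{p-1}` over `ZMod p` (Frobenius `(X-1)^p = X^p - 1` and the telescoping
`(∑_{m<p} X^m)(X-1) = X^p - 1`; the same four lines as `FeketeNoSparseSplitCyclic.fmo_geom_sum_eq`). [folklore] -/
theorem socle_geom_sum_eq (p : ℕ) [Fact p.Prime] :
    (∑ m ∈ range p, (X : (ZMod p)[X]) ^ m) = (X - C 1) ^ (p - 1) := by
  have hp : p.Prime := Fact.out
  have hfrob : (X - C (1 : ZMod p)) ^ p = X ^ p - 1 := by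
    rw [sub_pow_char, ← C_pow, one_pow, C_1]
  apply mul_right_cancel₀ (X_sub_C_ne_zero (1 : ZMod p))
  rw [← pow_succ, Nat.sub_add_cancel hp.one_le, hfrob, C_1, geom_sum_mul]

/-- **The socle tiling as an `OrdSparsitySum` instance**: for `p` prime and `2 ≤ a < p` there are two pairs
`A = ([a]_X, X^{a(p/a)})`, `B = (∑_{j<p/a} X^{aj}, [p mod a]_X)` over `ZMod p` with factors of degree `< p`,
`∑_j A_j B_j = (X-1)^{p-1}` not divisible by `X^p - 1 = (X-1)^p` but divisible by `(X-1)^{p-1}`, and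
support-sum at most `2a + p/a`. -/
theorem socle_witness (p a : ℕ) [hp : Fact p.Prime] (ha : 2 ≤ a) (hap : a < p) :
    ∃ A B : Fin 2 → (ZMod p)[X],
      (∀ j, (A j).natDegree < p ∧ (B j).natDegree < p) ∧
      ¬ ((X : (ZMod p)[X]) ^ p - 1 ∣ ∑ j, A j * B j) ∧
      ((X - 1 : (ZMod p)[X]) ^ (p - 1) ∣ ∑ j, A j * B j) ∧
      (∑ j, ((A j).support.card + (B j).support.card)) ≤ 2 * a + p / a := by
  have hprime := hp.out
  have hp0 : 0 < p := hprime.pos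
  have ha0 : 0 < a := by omega
  have hc0 : 0 < p % a := by
    rw [Nat.pos_iff_ne_zero]
    intro h
    have hdvd : a ∣ p := Nat.dvd_of_mod_eq_zero h
    rcases (Nat.dvd_prime hprime).mp hdvd with h1 | h1 <;> omega
  have hca : p % a < a := Nat.mod_lt _ ha0
  have hdm : a * (p / a) + p % a = p := Nat.div_add_mod p a
  have hab : a * (p / a) < p := by omega
  -- the sum of the two products is the socle
  have hsum : (∑ j, (![∑ i ∈ range a, X ^ i, X ^ (a * (p / a))] : Fin 2 → (ZMod p)[X]) j *
      (![∑ j ∈ range (p / a), X ^ (a * j), ∑ i ∈ range (p % a), X ^ i] : Fin 2 → (ZMod p)[X]) j) =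
        (X - C 1) ^ (p - 1) := by
    have h := socle_tiling_identity (ZMod p) a (p / a) (p % a)
    rw [Nat.div_add_mod, socle_geom_sum_eq] at h
    rw [Fin.sum_univ_two]
    simp only [Matrix.cons_val_zero, Matrix.cons_val_one]
    exact h.symm
  refine ⟨![∑ i ∈ range a, X ^ i, X ^ (a * (p / a))],
    ![∑ j ∈ range (p / a), X ^ (a * j), ∑ i ∈ range (p % a), X ^ i], ?_, ?_, ?_, ?_⟩
  · rw [Fin.forall_fin_two]
    simp only [Matrix.cons_val_zero, Matrix.cons_val_one]
    exact ⟨⟨socle_natDegree_geom_lt hap.le hp0, socle_natDegree_step_lt ha0 hab.le hp0⟩,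
      ⟨lt_of_le_of_lt (natDegree_X_pow_le _) hab, socle_natDegree_geom_lt (by omega) hp0⟩⟩
  · rw [hsum]
    intro hdvd
    have hfrob : (X : (ZMod p)[X]) ^ p - 1 = (X - C 1) ^ p := by
      rw [sub_pow_char, ← C_pow, one_pow, C_1]
    rw [hfrob] at hdvd
    have hne : (X - C (1 : ZMod p)) ^ (p - 1) ≠ 0 := pow_ne_zero _ (X_sub_C_ne_zero 1)
    have hdeg := natDegree_le_of_dvd hdvd hne
    rw [(monic_X_sub_C (1 : ZMod p)).natDegree_pow, (monic_X_sub_C (1 : ZMod p)).natDegree_pow,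
      natDegree_X_sub_C] at hdeg
    omega
  · rw [hsum, ← C_1]
  · rw [Fin.sum_univ_two]
    simp only [Matrix.cons_val_zero, Matrix.cons_val_one]
    have h1 := socle_card_support_geom_le (K := ZMod p) a
    have h2 := socle_card_support_step_le (K := ZMod p) a (p / a)
    have h3 : ((X : (ZMod p)[X]) ^ (a * (p / a))).support.card ≤ 1 := by
      rw [← one_mul ((X : (ZMod p)[X]) ^ (a * (p / a))), ← C_1]; exact card_support_C_mul_X_pow_le_one
    have h4 := socle_card_support_geom_le (K := ZMod p) (p % a)
    omega

/-! ## The refutations -/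

/-- **`OrdSparsitySumWeak C e num den` is false for all parameters** (verbatim the card's
`EulerMultiplicityTau.OrdSparsitySumWeak`, exponent renamed `a ↦ e`, `pairSparsity` unfolded; the linear case
`num = den = 1`, `e = 0` is the lead's `SketchStubs.not_ordSparsitySum`): with `a = ⌊√p⌋`
the socle tiling has `r = 2`, support-sum `T ≤ 3(a+1)` and order `p - 1 ≥ (a-1)(a+1)`, so
`((a-1)(a+1))^den ≤ C 2^e 3^num (a+1)^num ≤ C 2^e 3^num (a+1)^{2den-1}` forces `a - 1 ≤ C 2^e 3^{num+den-1}`,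
absurd for `p ≥ (C 2^e 3^{num+den} + 3)²`. -/
theorem ordSparsitySumWeak_false (C e num den : ℕ) :
    ¬ (num < 2 * den ∧
        ∀ (k : Type) [Field k] (p : ℕ) [Fact p.Prime] [CharP k p] (r : ℕ) (A B : Fin r → k[X]) (M : ℕ),
          (∀ j, (A j).natDegree < p ∧ (B j).natDegree < p) →
          ¬ ((X : k[X]) ^ p - 1 ∣ ∑ j, A j * B j) →
          (X - 1 : k[X]) ^ M ∣ ∑ j, A j * B j →
          M ^ den ≤ C * r ^ e * (∑ j, ((A j).support.card + (B j).support.card)) ^ num) := by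
  rintro ⟨hnd, h⟩
  obtain ⟨K₀, hK₀⟩ : ∃ K₀, K₀ = C * 2 ^ e * 3 ^ (num + den) := ⟨_, rfl⟩
  obtain ⟨p, hp, hprime⟩ := Nat.exists_infinite_primes ((K₀ + 3) ^ 2)
  haveI : Fact p.Prime := ⟨hprime⟩
  obtain ⟨a, ha⟩ : ∃ a, a = Nat.sqrt p := ⟨_, rfl⟩
  have haK : K₀ + 3 ≤ a := by rw [ha, Nat.le_sqrt']; exact hp
  have haa : a ^ 2 ≤ p := by rw [ha]; exact Nat.sqrt_le' p
  have hpa : p < (a + 1) ^ 2 := by rw [ha]; exact Nat.lt_succ_sqrt' p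
  obtain ⟨n, rfl⟩ : ∃ n, a = n + 2 := ⟨a - 2, by omega⟩
  have hap : n + 2 < p := by nlinarith
  obtain ⟨A, B, hdeg, hndvd, hdvd, hsupp⟩ := socle_witness p (n + 2) (by omega) hap
  have key := h (ZMod p) p 2 A B (p - 1) hdeg hndvd hdvd
  obtain ⟨T, hT⟩ : ∃ T, T = ∑ j, ((A j).support.card + (B j).support.card) := ⟨_, rfl⟩
  rw [← hT] at key hsupp
  -- `T ≤ 3(n+3)` and `p - 1 ≥ (n+1)(n+3)`
  have hq : p / (n + 2) ≤ n + 2 + 2 := by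
    apply Nat.div_le_of_le_mul
    nlinarith
  have hT3 : T ≤ 3 * (n + 3) := by omega
  have hbase : (n + 1) * (n + 3) ≤ p - 1 := by
    have h' : (n + 1) * (n + 3) + 1 = (n + 2) ^ 2 := by ring
    omega
  obtain ⟨d, rfl⟩ : ∃ d, den = d + 1 := ⟨den - 1, by omega⟩
  have hnum : num ≤ d + 1 + d := by omega
  have h3pos : 0 < n + 3 := by omega
  have h1pos : 0 < n + 1 := by omega
  -- the chain of elementary inequalities
  have c1 : ((n + 1) * (n + 3)) ^ (d + 1) ≤ C * 2 ^ e * (3 * (n + 3)) ^ num :=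
    calc ((n + 1) * (n + 3)) ^ (d + 1) ≤ (p - 1) ^ (d + 1) := Nat.pow_le_pow_left hbase _
      _ ≤ C * 2 ^ e * T ^ num := key
      _ ≤ C * 2 ^ e * (3 * (n + 3)) ^ num := Nat.mul_le_mul_left _ (Nat.pow_le_pow_left hT3 _)
  have c2 : (3 * (n + 3)) ^ num ≤ 3 ^ num * ((n + 3) ^ (d + 1) * (n + 3) ^ d) := by
    rw [mul_pow, ← pow_add]
    exact Nat.mul_le_mul_left _ (Nat.pow_le_pow_right h3pos hnum)
  have c3 : (n + 1) ^ (d + 1) * (n + 3) ^ (d + 1) ≤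
      (C * 2 ^ e * 3 ^ num * (n + 3) ^ d) * (n + 3) ^ (d + 1) :=
    calc (n + 1) ^ (d + 1) * (n + 3) ^ (d + 1) = ((n + 1) * (n + 3)) ^ (d + 1) := (mul_pow _ _ _).symm
      _ ≤ C * 2 ^ e * (3 * (n + 3)) ^ num := c1
      _ ≤ C * 2 ^ e * (3 ^ num * ((n + 3) ^ (d + 1) * (n + 3) ^ d)) := Nat.mul_le_mul_left _ c2
      _ = (C * 2 ^ e * 3 ^ num * (n + 3) ^ d) * (n + 3) ^ (d + 1) := by ring
  have c4 : (n + 1) ^ (d + 1) ≤ C * 2 ^ e * 3 ^ num * (n + 3) ^ d :=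
    Nat.le_of_mul_le_mul_right c3 (pow_pos h3pos _)
  have c5 : (n + 3) ^ d ≤ 3 ^ d * (n + 1) ^ d := by
    rw [← mul_pow]; exact Nat.pow_le_pow_left (by omega) _
  have c6 : (n + 1) * (n + 1) ^ d ≤ (C * 2 ^ e * 3 ^ num * 3 ^ d) * (n + 1) ^ d :=
    calc (n + 1) * (n + 1) ^ d = (n + 1) ^ (d + 1) := (pow_succ' _ _).symm
      _ ≤ C * 2 ^ e * 3 ^ num * (n + 3) ^ d := c4
      _ ≤ C * 2 ^ e * 3 ^ num * (3 ^ d * (n + 1) ^ d) := Nat.mul_le_mul_left _ c5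
      _ = (C * 2 ^ e * 3 ^ num * 3 ^ d) * (n + 1) ^ d := by ring
  have c7 : n + 1 ≤ C * 2 ^ e * 3 ^ num * 3 ^ d := Nat.le_of_mul_le_mul_right c6 (pow_pos h1pos _)
  have c8 : C * 2 ^ e * 3 ^ num * 3 ^ d ≤ K₀ := by
    rw [hK₀, mul_assoc (C * 2 ^ e), ← pow_add]
    exact Nat.mul_le_mul_left _ (Nat.pow_le_pow_right (by norm_num) (by omega))
  omega

end

end Summit.ValiantsHypothesis.ValiantsHypothesis.Theorems.FeketeSOSHard.Negative
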